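import Summits.CriticalPhenomena.PercolationContinuityZ3.Theorems.PercNearOneGluingNoHeavyLowerTailCILOvertakingBound
import HarnessLib

/-!
# `NoHeavyLowerTail` (stmt-CriticalPhenomena-4575) — the overtaking bound in TPS shape: the two-sided kernel of the hull-port step
# from ONE comparison `D_x ≥ Ω_x`, and under ROBUST DOMINATION

Support file (prover `prim-hp-3`, hull-port line; `--supports stmt-CriticalPhenomena-4575`).  No definitions, no named facts, no sorries.
Crux notes: run/shared/lean/prim/prim-hp-3/HULLPORT-REF-gen2.md §9/§12.

`Hyperedge.overtaking_bound` (…CILOvertakingBound) proves `I_w(i) − I_w(x) − Ω_x ≤ F` for the separated margin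
`F = μ_w(i ↮ {s₁,s₂}, |π(i)| ≤ j) − μ_w(i ↮ {s₁,s₂}, 1 ≤ |π(s₁) ∪ π(s₂)| ≤ j)` of two non-relay observers `s₁ ≠ s₂` with ports in
`P₁, P₂ ⊆ A`, any relay `x`, and the explicit OVERTAKING MASS `Ω_x` (cells of the double star expansion).  This file states the two
consequences in exactly the shape consumed by the two-pendant-stars assembly (`cil_twoPendantStars_of_TPS`, hypothesis `hTPS`, prover
`prim-hp-2`) and by `Hyperedge.setCS_pair_of_hyperedgeDD`-type reductions:

* `Hyperedge.tps_of_overtaking` — **if `Ω_x ≤ I_w(i) − I_w(x)` for some relay `x` then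
  `μ_w(i ↮ {s₁,s₂}, 1 ≤ |π(s₁)∪π(s₂)| ≤ j) ≤ μ_w(i ↮ {s₁,s₂}, |π(i)| ≤ j)`** (`= CS_w({s₁,s₂}, i)`, the two-sided kernel).
* `Hyperedge.tps_of_robustDomination` — **ROBUST DOMINATION suffices**: if `I_w(x) ≤ I_w(i)` and in every cell `(T,S)` of the double star
  expansion neither glued block is lighter-more-often than `x` (`max ℓ_T ℓ_S ≤ c₂(x)`, all under `K = (w∖s₂)∖s₁`), then `Ω_x = 0` and the
  kernel holds.  This is the first proved form of the two-sided kernel for arbitrary port sets `P₁, P₂` and every level `j` with a single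
  comparison hypothesis (coverage of the criterion among random TPS instances: 99.76 % in ttrl2's 2.26 M-pair census, halflin README §8b;
  the residue is the overtaking/tie locus).
-/

noncomputable section

namespace Summit.CriticalPhenomena.PercolationContinuityZ3.Theorems

open MeasureTheory Set Literature.Probability.LatticeModels Literature.Probability.Percolation
open scoped Classical BigOperators

variable {n : ℕ}

namespace Hyperedge

/-- **The two-sided kernel from one comparison covering the overtaking mass.**  In the setting of `Hyperedge.overtaking_bound`
(two non-relay observers `s₁ ≠ s₂` with ports in `P₁, P₂ ⊆ A`, a relay `i ∉ P₂`, any relay `x`): if `Ω_x ≤ I_w(i) − I_w(x)` then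
`μ_w(i ↮ {s₁,s₂}, 1 ≤ |π(s₁) ∪ π(s₂)| ≤ j) ≤ μ_w(i ↮ {s₁,s₂}, |π(i)| ≤ j)`, i.e. `CS_w({s₁,s₂}, i)` — the hypothesis `hTPS` of
`cil_twoPendantStars_of_TPS`.  [this work; crux notes HULLPORT-REF-gen2.md §9] -/
theorem tps_of_overtaking (w : Sym2 (Fin n) → unitInterval) (A : Finset (Fin n)) (s₁ s₂ i x : Fin n)
    (P₁ P₂ : Finset (Fin n)) (j : ℕ) (h1A : s₁ ∉ A) (h2A : s₂ ∉ A) (hiA : i ∈ A) (hxA : x ∈ A) (h12 : s₁ ≠ s₂)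
    (h1P1 : s₁ ∉ P₁) (h2P2 : s₂ ∉ P₂) (hiP2 : i ∉ P₂) (hP1A : P₁ ⊆ A) (hP2A : P₂ ⊆ A)
    (hobs₁ : ∀ y, y ≠ s₁ → y ∉ P₁ → w s(s₁, y) = 0) (hobs₂ : ∀ y, y ≠ s₂ → y ∉ P₂ → w s(s₂, y) = 0)
    (hD : ∑ S ∈ P₂.powerset, (prodBernoulli w).real (starEvent s₂ (↑S : Set (Fin n))) *
          ∑ T ∈ P₁.powerset,
            (prodBernoulli (fun e => if s₂ ∈ e then (0 : unitInterval) else w e)).real (starEvent s₁ (↑T : Set (Fin n))) *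
            max 0 (max ((prodBernoulli (fun e => if s₁ ∈ e then (0 : unitInterval) else if s₂ ∈ e then (0 : unitInterval) else w e)).real {ω : BondConfig (Fin n) | 1 ≤ (A.filter fun z => ∃ u ∈ T, (((openGraph ω).Reachable u z ∨ ((∃ t ∈ T, (openGraph ω).Reachable u t) ∧ ∃ t ∈ T, (openGraph ω).Reachable t z)) ∨ ((∃ s ∈ S, (openGraph ω).Reachable u s ∨ ((∃ t ∈ T, (openGraph ω).Reachable u t) ∧ ∃ t ∈ T, (openGraph ω).Reachable t s)) ∧ ∃ s ∈ S, (openGraph ω).Reachable s z ∨ ((∃ t ∈ T, (openGraph ω).Reachable s t) ∧ ∃ t ∈ T, (openGraph ω).Reachable t z)))).card ∧ (A.filter fun z => ∃ u ∈ T, (((openGraph ω).Reachable u z ∨ ((∃ t ∈ T, (openGraph ω).Reachable u t) ∧ ∃ t ∈ T, (openGraph ω).Reachable t z)) ∨ ((∃ s ∈ S, (openGraph ω).Reachable u s ∨ ((∃ t ∈ T, (openGraph ω).Reachable u t) ∧ ∃ t ∈ T, (openGraph ω).Reachable t s)) ∧ ∃ s ∈ S, (openGraph ω).Reachable s z ∨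 ((∃ t ∈ T, (openGraph ω).Reachable s t) ∧ ∃ t ∈ T, (openGraph ω).Reachable t z)))).card ≤ j})
              ((prodBernoulli (fun e => if s₁ ∈ e then (0 : unitInterval) else if s₂ ∈ e then (0 : unitInterval) else w e)).real {ω : BondConfig (Fin n) | 1 ≤ (A.filter fun z => ∃ u ∈ S, (((openGraph ω).Reachable u z ∨ ((∃ t ∈ T, (openGraph ω).Reachable u t) ∧ ∃ t ∈ T, (openGraph ω).Reachable t z)) ∨ ((∃ s ∈ S, (openGraph ω).Reachable u s ∨ ((∃ t ∈ T, (openGraph ω).Reachable u t) ∧ ∃ t ∈ T, (openGraph ω).Reachable t s)) ∧ ∃ s ∈ S, (openGraph ω).Reachable s z ∨ ((∃ t ∈ T, (openGraph ω).Reachable s t) ∧ ∃ t ∈ T, (openGraph ω).Reachable t z)))).card ∧ (A.filter fun z => ∃ u ∈ S, (((openGraph ω).Reachable u z ∨ ((∃ t ∈ T, (openGraph ω).Reachable u t) ∧ ∃ t ∈ T, (openGraph ω).Reachable t z)) ∨ ((∃ s ∈ S, (openGraph ω).Reachable u s ∨ ((∃ t ∈ T, (openGraph ω).Reachable u t) ∧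 ∃ t ∈ T, (openGraph ω).Reachable t s)) ∧ ∃ s ∈ S, (openGraph ω).Reachable s z ∨ ((∃ t ∈ T, (openGraph ω).Reachable s t) ∧ ∃ t ∈ T, (openGraph ω).Reachable t z)))).card ≤ j}) -
              (prodBernoulli (fun e => if s₁ ∈ e then (0 : unitInterval) else if s₂ ∈ e then (0 : unitInterval) else w e)).real {ω : BondConfig (Fin n) | (A.filter fun z => (((openGraph ω).Reachable x z ∨ ((∃ c ∈ T, (openGraph ω).Reachable c x) ∧ ∃ c' ∈ T, (openGraph ω).Reachable c' z)) ∨ ((∃ s ∈ S, (openGraph ω).Reachable s x ∨ ((∃ c ∈ T, (openGraph ω).Reachable c s) ∧ ∃ c' ∈ T, (openGraph ω).Reachable c' x)) ∧ ∃ s' ∈ S, (openGraph ω).Reachable s' z ∨ ((∃ c ∈ T, (openGraph ω).Reachable c s') ∧ ∃ c' ∈ T, (openGraph ω).Reachable c' z)))).card ≤ j}) ≤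
      (prodBernoulli w).real {ω : BondConfig (Fin n) | (A.filter fun z => ω ∈ openConn i z).card ≤ j} -
        (prodBernoulli w).real {ω : BondConfig (Fin n) | (A.filter fun z => ω ∈ openConn x z).card ≤ j}) :
    (prodBernoulli w).real {ω : BondConfig (Fin n) | (∀ x ∈ ({s₁, s₂} : Finset (Fin n)), ω ∉ openConn i x) ∧
        1 ≤ (A.filter fun z => ∃ x ∈ ({s₁, s₂} : Finset (Fin n)), ω ∈ openConn x z).card ∧
        (A.filter fun z => ∃ x ∈ ({s₁, s₂} : Finset (Fin n)), ω ∈ openConn x z).card ≤ j} ≤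
      (prodBernoulli w).real {ω : BondConfig (Fin n) | (∀ x ∈ ({s₁, s₂} : Finset (Fin n)), ω ∉ openConn i x) ∧
        (A.filter fun z => ω ∈ openConn i z).card ≤ j} := by
  have h := overtaking_bound w A s₁ s₂ i x P₁ P₂ j h1A h2A hiA hxA h12 h1P1 h2P2 hiP2 hP1A hP2A hobs₁ hobs₂
  linarith

/-- **The two-sided kernel under ROBUST DOMINATION.**  Same setting; if `I_w(x) ≤ I_w(i)` for a relay `x` and, in every cell
`(T, S)` (`T ⊆ P₁`, `S ⊆ P₂`) of the double star expansion, the glued blocks satisfy `max ℓ_T ℓ_S ≤ c₂(x)` under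
`K = (w∖s₂)∖s₁` (no glued sub-block of the two stars is light more often than `x`: "robust domination"), then the overtaking mass
vanishes and `μ_w(i ↮ {s₁,s₂}, 1 ≤ |π(s₁) ∪ π(s₂)| ≤ j) ≤ μ_w(i ↮ {s₁,s₂}, |π(i)| ≤ j)`.  [this work] -/
theorem tps_of_robustDomination (w : Sym2 (Fin n) → unitInterval) (A : Finset (Fin n)) (s₁ s₂ i x : Fin n)
    (P₁ P₂ : Finset (Fin n)) (j : ℕ) (h1A : s₁ ∉ A) (h2A : s₂ ∉ A) (hiA : i ∈ A) (hxA : x ∈ A) (h12 : s₁ ≠ s₂)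
    (h1P1 : s₁ ∉ P₁) (h2P2 : s₂ ∉ P₂) (hiP2 : i ∉ P₂) (hP1A : P₁ ⊆ A) (hP2A : P₂ ⊆ A)
    (hobs₁ : ∀ y, y ≠ s₁ → y ∉ P₁ → w s(s₁, y) = 0) (hobs₂ : ∀ y, y ≠ s₂ → y ∉ P₂ → w s(s₂, y) = 0)
    (hdom : (prodBernoulli w).real {ω : BondConfig (Fin n) | (A.filter fun z => ω ∈ openConn x z).card ≤ j} ≤
      (prodBernoulli w).real {ω : BondConfig (Fin n) | (A.filter fun z => ω ∈ openConn i z).card ≤ j})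
    (hrobust : ∀ S ∈ P₂.powerset, ∀ T ∈ P₁.powerset,
      max ((prodBernoulli (fun e => if s₁ ∈ e then (0 : unitInterval) else if s₂ ∈ e then (0 : unitInterval) else w e)).real {ω : BondConfig (Fin n) | 1 ≤ (A.filter fun z => ∃ u ∈ T, (((openGraph ω).Reachable u z ∨ ((∃ t ∈ T, (openGraph ω).Reachable u t) ∧ ∃ t ∈ T, (openGraph ω).Reachable t z)) ∨ ((∃ s ∈ S, (openGraph ω).Reachable u s ∨ ((∃ t ∈ T, (openGraph ω).Reachable u t) ∧ ∃ t ∈ T, (openGraph ω).Reachable t s)) ∧ ∃ s ∈ S, (openGraph ω).Reachable s z ∨ ((∃ t ∈ T, (openGraph ω).Reachable s t) ∧ ∃ t ∈ T, (openGraph ω).Reachable t z)))).card ∧ (A.filter fun z => ∃ u ∈ T, (((openGraph ω).Reachable u z ∨ ((∃ t ∈ T, (openGraph ω).Reachable u t) ∧ ∃ t ∈ T, (openGraph ω).Reachable t z)) ∨ ((∃ s ∈ S, (openGraph ω).Reachable u s ∨ ((∃ t ∈ T, (openGraph ω).Reachable u t) ∧ ∃ t ∈ T, (openGraph ω).Reachable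 t s)) ∧ ∃ s ∈ S, (openGraph ω).Reachable s z ∨ ((∃ t ∈ T, (openGraph ω).Reachable s t) ∧ ∃ t ∈ T, (openGraph ω).Reachable t z)))).card ≤ j})
          ((prodBernoulli (fun e => if s₁ ∈ e then (0 : unitInterval) else if s₂ ∈ e then (0 : unitInterval) else w e)).real {ω : BondConfig (Fin n) | 1 ≤ (A.filter fun z => ∃ u ∈ S, (((openGraph ω).Reachable u z ∨ ((∃ t ∈ T, (openGraph ω).Reachable u t) ∧ ∃ t ∈ T, (openGraph ω).Reachable t z)) ∨ ((∃ s ∈ S, (openGraph ω).Reachable u s ∨ ((∃ t ∈ T, (openGraph ω).Reachable u t) ∧ ∃ t ∈ T, (openGraph ω).Reachable t s)) ∧ ∃ s ∈ S, (openGraph ω).Reachable s z ∨ ((∃ t ∈ T, (openGraph ω).Reachable s t) ∧ ∃ t ∈ T, (openGraph ω).Reachable t z)))).card ∧ (A.filter fun z => ∃ u ∈ S, (((openGraph ω).Reachable u z ∨ ((∃ t ∈ T, (openGraph ω).Reachable u t) ∧ ∃ t ∈ T, (openGraph ω).Reachable t z)) ∨ ((∃ s ∈ S, (openGraph ω).Reachable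 u s ∨ ((∃ t ∈ T, (openGraph ω).Reachable u t) ∧ ∃ t ∈ T, (openGraph ω).Reachable t s)) ∧ ∃ s ∈ S, (openGraph ω).Reachable s z ∨ ((∃ t ∈ T, (openGraph ω).Reachable s t) ∧ ∃ t ∈ T, (openGraph ω).Reachable t z)))).card ≤ j}) ≤
        (prodBernoulli (fun e => if s₁ ∈ e then (0 : unitInterval) else if s₂ ∈ e then (0 : unitInterval) else w e)).real {ω : BondConfig (Fin n) | (A.filter fun z => (((openGraph ω).Reachable x z ∨ ((∃ c ∈ T, (openGraph ω).Reachable c x) ∧ ∃ c' ∈ T, (openGraph ω).Reachable c' z)) ∨ ((∃ s ∈ S, (openGraph ω).Reachable s x ∨ ((∃ c ∈ T, (openGraph ω).Reachable c s) ∧ ∃ c' ∈ T, (openGraph ω).Reachable c' x)) ∧ ∃ s' ∈ S, (openGraph ω).Reachable s' z ∨ ((∃ c ∈ T, (openGraph ω).Reachable c s') ∧ ∃ c' ∈ T, (openGraph ω).Reachable c' z)))).card ≤ j}) :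
    (prodBernoulli w).real {ω : BondConfig (Fin n) | (∀ x ∈ ({s₁, s₂} : Finset (Fin n)), ω ∉ openConn i x) ∧
        1 ≤ (A.filter fun z => ∃ x ∈ ({s₁, s₂} : Finset (Fin n)), ω ∈ openConn x z).card ∧
        (A.filter fun z => ∃ x ∈ ({s₁, s₂} : Finset (Fin n)), ω ∈ openConn x z).card ≤ j} ≤
      (prodBernoulli w).real {ω : BondConfig (Fin n) | (∀ x ∈ ({s₁, s₂} : Finset (Fin n)), ω ∉ openConn i x) ∧
        (A.filter fun z => ω ∈ openConn i z).card ≤ j} := by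
  have hΩ : ∑ S ∈ P₂.powerset, (prodBernoulli w).real (starEvent s₂ (↑S : Set (Fin n))) *
          ∑ T ∈ P₁.powerset,
            (prodBernoulli (fun e => if s₂ ∈ e then (0 : unitInterval) else w e)).real (starEvent s₁ (↑T : Set (Fin n))) *
            max 0 (max ((prodBernoulli (fun e => if s₁ ∈ e then (0 : unitInterval) else if s₂ ∈ e then (0 : unitInterval) else w e)).real {ω : BondConfig (Fin n) | 1 ≤ (A.filter fun z => ∃ u ∈ T, (((openGraph ω).Reachable u z ∨ ((∃ t ∈ T, (openGraph ω).Reachable u t) ∧ ∃ t ∈ T, (openGraph ω).Reachable t z)) ∨ ((∃ s ∈ S, (openGraph ω).Reachable u s ∨ ((∃ t ∈ T, (openGraph ω).Reachable u t) ∧ ∃ t ∈ T, (openGraph ω).Reachable t s)) ∧ ∃ s ∈ S, (openGraph ω).Reachable s z ∨ ((∃ t ∈ T, (openGraph ω).Reachable s t) ∧ ∃ t ∈ T, (openGraph ω).Reachable t z)))).card ∧ (A.filter fun z => ∃ u ∈ T, (((openGraph ω).Reachable u z ∨ ((∃ t ∈ T, (openGraph ω).Reachable u t) ∧ ∃ t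 ∈ T, (openGraph ω).Reachable t z)) ∨ ((∃ s ∈ S, (openGraph ω).Reachable u s ∨ ((∃ t ∈ T, (openGraph ω).Reachable u t) ∧ ∃ t ∈ T, (openGraph ω).Reachable t s)) ∧ ∃ s ∈ S, (openGraph ω).Reachable s z ∨ ((∃ t ∈ T, (openGraph ω).Reachable s t) ∧ ∃ t ∈ T, (openGraph ω).Reachable t z)))).card ≤ j})
              ((prodBernoulli (fun e => if s₁ ∈ e then (0 : unitInterval) else if s₂ ∈ e then (0 : unitInterval) else w e)).real {ω : BondConfig (Fin n) | 1 ≤ (A.filter fun z => ∃ u ∈ S, (((openGraph ω).Reachable u z ∨ ((∃ t ∈ T, (openGraph ω).Reachable u t) ∧ ∃ t ∈ T, (openGraph ω).Reachable t z)) ∨ ((∃ s ∈ S, (openGraph ω).Reachable u s ∨ ((∃ t ∈ T, (openGraph ω).Reachable u t) ∧ ∃ t ∈ T, (openGraph ω).Reachable t s)) ∧ ∃ s ∈ S, (openGraph ω).Reachable s z ∨ ((∃ t ∈ T, (openGraph ω).Reachable s t) ∧ ∃ t ∈ T, (openGraph ω).Reachable t z)))).card ∧ (A.filter fun z => ∃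 u ∈ S, (((openGraph ω).Reachable u z ∨ ((∃ t ∈ T, (openGraph ω).Reachable u t) ∧ ∃ t ∈ T, (openGraph ω).Reachable t z)) ∨ ((∃ s ∈ S, (openGraph ω).Reachable u s ∨ ((∃ t ∈ T, (openGraph ω).Reachable u t) ∧ ∃ t ∈ T, (openGraph ω).Reachable t s)) ∧ ∃ s ∈ S, (openGraph ω).Reachable s z ∨ ((∃ t ∈ T, (openGraph ω).Reachable s t) ∧ ∃ t ∈ T, (openGraph ω).Reachable t z)))).card ≤ j}) -
              (prodBernoulli (fun e => if s₁ ∈ e then (0 : unitInterval) else if s₂ ∈ e then (0 : unitInterval) else w e)).real {ω : BondConfig (Fin n) | (A.filter fun z => (((openGraph ω).Reachable x z ∨ ((∃ c ∈ T, (openGraph ω).Reachable c x) ∧ ∃ c' ∈ T, (openGraph ω).Reachable c' z)) ∨ ((∃ s ∈ S, (openGraph ω).Reachable s x ∨ ((∃ c ∈ T, (openGraph ω).Reachable c s) ∧ ∃ c' ∈ T, (openGraph ω).Reachable c' x)) ∧ ∃ s' ∈ S, (openGraph ω).Reachable s' z ∨ ((∃ c ∈ T, (openGraph ω).Reachable c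 s') ∧ ∃ c' ∈ T, (openGraph ω).Reachable c' z)))).card ≤ j}) = 0 := by
    refine Finset.sum_eq_zero fun S hS => ?_
    rw [Finset.sum_eq_zero fun T hT => ?_, mul_zero]
    rw [max_eq_left (sub_nonpos.2 (hrobust S hS T hT)), mul_zero]
  have h := overtaking_bound w A s₁ s₂ i x P₁ P₂ j h1A h2A hiA hxA h12 h1P1 h2P2 hiP2 hP1A hP2A hobs₁ hobs₂
  rw [hΩ] at h
  linarith

end Hyperedge

end Summit.CriticalPhenomena.PercolationContinuityZ3.Theorems
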